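import Summits.Langlands.Langlands.Theorems.IrreducibilityBySelfDualityReciprocityUpToIrreducibilityRHomAdditivity
import Summits.Langlands.Langlands.Theorems.IrreducibilityBySelfDualityReciprocityUpToIrreducibilityRHeadProbe
import Summits.Langlands.Langlands.Theorems.IrreducibilityBySelfDualityReciprocityUpToIrreducibilityRStringSummand
import Summits.Langlands.Langlands.Theorems.IrreducibilityBySelfDualityReciprocityUpToIrreducibilityRStringDim
import Summits.Langlands.Langlands.Theorems.IrreducibilityBySelfDualityReciprocityUpToIrreducibilityRModelHom
import Summits.Langlands.Langlands.Theorems.IrreducibilityBySelfDualityReciprocityUpToIrreducibilityRStringCount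
import HarnessLib

/-!
# Counting strings by `Hom`-dimensions (toward stub S-17a-B of line `Sketch`,
# crux stmt-Langlands-17925 `IrreducibilityBySelfDuality.ReciprocityUpToIrreducibilityR`)

Henniart 2002 (Bull. SMF 130), Thm 1.7 (a), §4, in the tree's language.  For a Weil–Deligne
representation `σ` on `V`, a sub-Weil–Deligne representation `U ≤ V` and a probe head `ρ` (a continuous
irreducible representation of `W_F` on `H`), write
`K_U(ρ, d) := dim Hom_WD(ρ ⊗ Sp(d), σ; U) = finrank (homWDIn (stringModel ρ hρ d) σ U)`.
This file proves: `K` vanishes on `U = 0`, is additive over internal direct sums (`…RHomAdditivity`),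
takes the value `[∃ i < e, ρ ≅ ρ_{H'} ⊗ ‖·‖^i ∧ e ≤ d + i]` on a single string `string(H', e)`
(`…RModelHom` + `…RStringCount`), stabilises in `d` beyond `dim U / dim H`, and that the combination
`c_U(ρ, d) := [K_U(ρ,d) - K_U(ρ,d-1)] - [K_U(ρ ⊗ ‖·‖⁻¹, d+1) - K_U(ρ ⊗ ‖·‖⁻¹, d)]`
COUNTS the string summands of `U` with head `≅ ρ` and length exactly `d`: it is `≥ 0`, equals
`[ρ ≅ ρ_{H'} ∧ d = e]` on `string(H', e)`, and when non-zero produces such a string summand of `U`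
(registered sub-goal `stub_exists_string_summand_of_count_ne_zero`).  No definitions.
-/

noncomputable section

set_option linter.dupNamespace false

open Module
open Literature.NumberTheory.Automorphic Literature.NumberTheory.GaloisRepresentations
open Literature.NumberTheory.GaloisRepresentations.WeilGroup
open Literature.NumberTheory.GaloisRepresentations.IsNonarchimedeanLocalField

namespace Summit.Langlands.Langlands.Theorems.ReciprocityUpToIrreducibilityR

variable {F : Type} [Field F] [ValuativeRel F] [TopologicalSpace F] [IsNonarchimedeanLocalField F]

/-! ## `K` on `0`, on sums, on a single string -/

section KBasic

variable {V : Type} [AddCommGroup V] [Module ℂ V] [FiniteDimensional ℂ V]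
variable {Hp : Type} [AddCommGroup Hp] [Module ℂ Hp] [FiniteDimensional ℂ Hp]

omit [FiniteDimensional ℂ V] in
/-- `Hom_WD(τ, σ; 0) = 0`. [folklore] -/
theorem homWDIn_bot {W : Type*} [AddCommGroup W] [Module ℂ W] (τ : WeilDeligneRep F ℂ W)
    (σ : WeilDeligneRep F ℂ V) : homWDIn τ σ ⊥ = ⊥ := by
  rw [eq_bot_iff]
  intro f hf
  rw [Submodule.mem_bot]
  exact LinearMap.ext fun x => (Submodule.mem_bot ℂ).mp (hf.2 x)

omit [FiniteDimensional ℂ V] [FiniteDimensional ℂ Hp] in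
/-- `K_0(ρ, d) = 0`. [folklore] -/
theorem K_bot (ρ : Representation ℂ (WeilGroup F) Hp) (hρ : WeilGroup.IsContinuousRep ρ) (d : ℕ)
    (σ : WeilDeligneRep F ℂ V) : finrank ℂ (homWDIn (stringModel ρ hρ d) σ ⊥) = 0 := by
  rw [homWDIn_bot, finrank_bot]

/-- `K` is monotone in `U`. [folklore] -/
theorem K_mono (ρ : Representation ℂ (WeilGroup F) Hp) (hρ : WeilGroup.IsContinuousRep ρ) (d : ℕ)
    (σ : WeilDeligneRep F ℂ V) {U U' : Submodule ℂ V} (h : U ≤ U') :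
    finrank ℂ (homWDIn (stringModel ρ hρ d) σ U) ≤ finrank ℂ (homWDIn (stringModel ρ hρ d) σ U') :=
  Submodule.finrank_mono (homWDIn_mono _ σ h)

/-- **`K` on a single string** (`…RModelHom` + `…RStringCount`): `K_{string(H',e)}(ρ, d) = 1` if
`ρ ≅ ρ_{H'} ⊗ ‖·‖^i` for some `i < e` with `e ≤ d + i`, else `0`. [cite: HenniartBSMF2002, §4] -/
theorem K_stringSpan (ρ : Representation ℂ (WeilGroup F) Hp) (hρ : WeilGroup.IsContinuousRep ρ)
    (hirr : ρ.IsIrreducible) (d : ℕ) {σ : WeilDeligneRep F ℂ V} {H' : Submodule ℂ V} {e : ℕ}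
    (h : IsStringHead σ H' e) :
    ((∃ i : ℕ, i < e ∧ IsoTw (σ.ρ.subrepresentation H' h.irreducible.2.1) (i : ℤ) ρ ∧ e ≤ d + i) →
      finrank ℂ (homWDIn (stringModel ρ hρ d) σ (stringSpan σ H' e)) = 1) ∧
    ((¬ ∃ i : ℕ, i < e ∧ IsoTw (σ.ρ.subrepresentation H' h.irreducible.2.1) (i : ℤ) ρ ∧ e ≤ d + i) →
      finrank ℂ (homWDIn (stringModel ρ hρ d) σ (stringSpan σ H' e)) = 0) := by
  rw [finrank_homWDIn_stringModel ρ hρ σ d (isSubrep_stringSpan h.irreducible.2.1 h.le_ker).2]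
  exact finrank_headSpace_stringSpan h hirr d

/-- `K ≤ 1` on a single string. [cite: HenniartBSMF2002, §4] -/
theorem K_stringSpan_le_one (ρ : Representation ℂ (WeilGroup F) Hp) (hρ : WeilGroup.IsContinuousRep ρ)
    (hirr : ρ.IsIrreducible) (d : ℕ) {σ : WeilDeligneRep F ℂ V} {H' : Submodule ℂ V} {e : ℕ}
    (h : IsStringHead σ H' e) : finrank ℂ (homWDIn (stringModel ρ hρ d) σ (stringSpan σ H' e)) ≤ 1 := by
  classical
  by_cases hc : ∃ i : ℕ, i < e ∧ IsoTw (σ.ρ.subrepresentation H' h.irreducible.2.1) (i : ℤ) ρ ∧ e ≤ d + i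
  · exact ((K_stringSpan ρ hρ hirr d h).1 hc).le
  · exact ((K_stringSpan ρ hρ hirr d h).2 hc).le.trans zero_le_one

/-- `K_U = K_S + K_C` for `U = S ⊕ C` (internal, sub-Weil–Deligne representations). [folklore] -/
theorem K_sup (ρ : Representation ℂ (WeilGroup F) Hp) (hρ : WeilGroup.IsContinuousRep ρ) (d : ℕ)
    (σ : WeilDeligneRep F ℂ V) {A B : Submodule ℂ V} (hA : σ.IsSubrep A) (hB : σ.IsSubrep B)
    (hAB : Disjoint A B) :
    finrank ℂ (homWDIn (stringModel ρ hρ d) σ (A ⊔ B)) =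
      finrank ℂ (homWDIn (stringModel ρ hρ d) σ A) + finrank ℂ (homWDIn (stringModel ρ hρ d) σ B) :=
  finrank_homWDIn_sup _ σ hA hB hAB

/-- `dim U = dim S + dim C` for `U = S ⊕ C`. [folklore] -/
theorem finrank_sup_of_disjoint {A B : Submodule ℂ V} (hAB : Disjoint A B) :
    finrank ℂ ↥(A ⊔ B) = finrank ℂ A + finrank ℂ B := by
  rw [← Submodule.finrank_sup_add_finrank_inf_eq, hAB.eq_bot, finrank_bot, add_zero]

/-- An unramified-twist isomorphism preserves dimension. [folklore] -/
theorem finrank_eq_of_isoTw {H₁ : Type*} [AddCommGroup H₁] [Module ℂ H₁] {H₂ : Type*} [AddCommGroup H₂]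
    [Module ℂ H₂] {ρ₁ : Representation ℂ (WeilGroup F) H₁} {ρ₂ : Representation ℂ (WeilGroup F) H₂}
    {i : ℤ} (h : IsoTw ρ₁ i ρ₂) : finrank ℂ H₁ = finrank ℂ H₂ := by
  obtain ⟨e⟩ := h
  exact e.toLinearEquiv.finrank_eq

end KBasic

/-! ## Stabilisation of `K` in `d` -/

section Stabilise

variable {V : Type} [AddCommGroup V] [Module ℂ V] [FiniteDimensional ℂ V]
variable {Hp : Type} [AddCommGroup Hp] [Module ℂ Hp] [FiniteDimensional ℂ Hp] [Nontrivial Hp]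

omit [Nontrivial Hp] in
/-- **Stabilisation.**  If `dim U ≤ B` then `K_U(ρ, d)` is constant for `d ≥ B / dim H`: a string
`string(H', e)` inside `U` with `ρ_{H'} ≅ ρ ⊗ ‖·‖^{-i}` has `dim H' = dim H` and `e · dim H ≤ B`, so its
condition `e ≤ d + i` holds for every `d ≥ B / dim H` (induct along string summands).
[cite: HenniartBSMF2002, §4] -/
theorem K_stable {σ : WeilDeligneRep F ℂ V} (hσ : σ.IsFrobSemisimple) (ρ : Representation ℂ (WeilGroup F) Hp)
    (hρ : WeilGroup.IsContinuousRep ρ) (hirr : ρ.IsIrreducible) (B : ℕ) :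
    ∀ (m : ℕ) (U : Submodule ℂ V), finrank ℂ U = m → σ.IsSubrep U → finrank ℂ U ≤ B →
      ∀ d d' : ℕ, B / finrank ℂ Hp ≤ d → B / finrank ℂ Hp ≤ d' →
        finrank ℂ (homWDIn (stringModel ρ hρ d) σ U) = finrank ℂ (homWDIn (stringModel ρ hρ d') σ U) := by
  intro m
  induction m using Nat.strong_induction_on with
  | _ m ih =>
    intro U hm hU hUB d d' hd hd'
    by_cases hU0 : U = ⊥
    · subst hU0; rw [K_bot, K_bot]
    obtain ⟨H', e, C, h, hSU, hC, hCU, hSC, hdisj⟩ := exists_isStringHead_summand hσ hU hU0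
    have hS := isSubrep_stringSpan h.irreducible.2.1 h.le_ker
    have hdimS : finrank ℂ ↥(stringSpan σ H' e) = e * finrank ℂ H' := finrank_stringSpan h
    have hH'0 : 0 < finrank ℂ H' :=
      finrank_pos_iff.mpr (Submodule.nontrivial_iff_ne_bot.mpr h.irreducible.1)
    have hS0 : 0 < finrank ℂ ↥(stringSpan σ H' e) := by rw [hdimS]; exact Nat.mul_pos h.pos hH'0
    have hdimU : finrank ℂ U = finrank ℂ ↥(stringSpan σ H' e) + finrank ℂ C := by
      rw [← hSC]; exact finrank_sup_of_disjoint hdisj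
    have hCm : finrank ℂ C < m := by omega
    rw [← hSC, K_sup ρ hρ d σ hS hC hdisj, K_sup ρ hρ d' σ hS hC hdisj,
      ih _ hCm C rfl hC (by omega) d d' hd hd']
    congr 1
    -- the single string: its condition does not depend on `d ≥ B / dim H`
    classical
    have key : ∀ d₀ : ℕ, B / finrank ℂ Hp ≤ d₀ →
        ((∃ i : ℕ, i < e ∧ IsoTw (σ.ρ.subrepresentation H' h.irreducible.2.1) (i : ℤ) ρ ∧ e ≤ d₀ + i) ↔
          ∃ i : ℕ, i < e ∧ IsoTw (σ.ρ.subrepresentation H' h.irreducible.2.1) (i : ℤ) ρ) := by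
      intro d₀ hd₀
      refine ⟨fun ⟨i, hi, hiso, _⟩ => ⟨i, hi, hiso⟩, fun ⟨i, hi, hiso⟩ => ⟨i, hi, hiso, ?_⟩⟩
      have hdim : finrank ℂ H' = finrank ℂ Hp := finrank_eq_of_isoTw hiso
      have h1 : e * finrank ℂ Hp ≤ B := by rw [← hdim, ← hdimS]; omega
      have h2 : e ≤ B / finrank ℂ Hp := (Nat.le_div_iff_mul_le (hdim ▸ hH'0)).mpr h1
      omega
    by_cases hc : ∃ i : ℕ, i < e ∧ IsoTw (σ.ρ.subrepresentation H' h.irreducible.2.1) (i : ℤ) ρ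
    · rw [(K_stringSpan ρ hρ hirr d h).1 ((key d hd).mpr hc), (K_stringSpan ρ hρ hirr d' h).1 ((key d' hd').mpr hc)]
    · rw [(K_stringSpan ρ hρ hirr d h).2 (fun h' => hc ((key d hd).mp h')),
        (K_stringSpan ρ hρ hirr d' h).2 (fun h' => hc ((key d' hd').mp h'))]

end Stabilise

/-! ## The string count `c_U(ρ, d)` -/

section Count

variable {V : Type} [AddCommGroup V] [Module ℂ V] [FiniteDimensional ℂ V]
variable {Hp : Type} [AddCommGroup Hp] [Module ℂ Hp] [FiniteDimensional ℂ Hp]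

omit [FiniteDimensional ℂ Hp] in
/-- `ρ ⊗ ‖·‖^b ≅ ρ ⊗ ‖·‖^b`. [folklore] -/
theorem isoTw_self_twist (ρ : Representation ℂ (WeilGroup F) Hp) (b : ℤ) : IsoTw ρ b (twistRep ρ b) :=
  ⟨Representation.Equiv.refl _⟩

omit [FiniteDimensional ℂ Hp] in
/-- `(ρ ⊗ ‖·‖^b) ⊗ ‖·‖^{-b} ≅ ρ`. [folklore] -/
theorem isoTw_twist_self (ρ : Representation ℂ (WeilGroup F) Hp) (b : ℤ) : IsoTw (twistRep ρ b) (-b) ρ := by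
  rw [IsoTw, twistRep_twistRep, add_neg_cancel, twistRep_zero]
  exact ⟨Representation.Equiv.refl _⟩

omit [FiniteDimensional ℂ Hp] in
/-- `ρ₁ ⊗ ‖·‖^i ≅ ρ ⊗ ‖·‖⁻¹ ↔ ρ₁ ⊗ ‖·‖^{i+1} ≅ ρ`. [folklore] -/
theorem isoTw_twist_neg_one_iff {H₁ : Type*} [AddCommGroup H₁] [Module ℂ H₁]
    (ρ₁ : Representation ℂ (WeilGroup F) H₁) (ρ : Representation ℂ (WeilGroup F) Hp) (i : ℤ) :
    IsoTw ρ₁ i (twistRep ρ (-1)) ↔ IsoTw ρ₁ (i + 1) ρ := by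
  constructor
  · intro h
    have := h.trans (isoTw_twist_self ρ (-1))
    rwa [neg_neg] at this
  · intro h
    have := h.trans (isoTw_self_twist ρ (-1))
    rwa [add_neg_cancel_right] at this

variable {σ : WeilDeligneRep F ℂ V}

omit [FiniteDimensional ℂ V] [FiniteDimensional ℂ Hp] in
/-- `c` vanishes on `U = 0`. [folklore] -/
theorem c_bot (ρ : Representation ℂ (WeilGroup F) Hp) (hρ : WeilGroup.IsContinuousRep ρ) (d : ℕ) :
    ((Module.finrank ℂ (homWDIn (stringModel (ρ) (hρ) d) (σ) (⊥)) : ℤ) - (Module.finrank ℂ (homWDIn (stringModel (ρ) (hρ) (d - 1)) (σ) (⊥)) : ℤ) -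
      ((Module.finrank ℂ (homWDIn (stringModel (twistRep (ρ) (-1)) (isContinuousRep_twistRep (hρ) (-1)) (d + 1)) (σ) (⊥)) : ℤ) -
        (Module.finrank ℂ (homWDIn (stringModel (twistRep (ρ) (-1)) (isContinuousRep_twistRep (hρ) (-1)) d) (σ) (⊥)) : ℤ))) = 0 := by
  simp only [K_bot, Nat.cast_zero, sub_self]

/-- `c` is additive over internal direct sums of sub-Weil–Deligne representations. [folklore] -/
theorem c_sup (ρ : Representation ℂ (WeilGroup F) Hp) (hρ : WeilGroup.IsContinuousRep ρ) (d : ℕ)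
    {A B : Submodule ℂ V} (hA : σ.IsSubrep A) (hB : σ.IsSubrep B) (hAB : Disjoint A B) :
    ((Module.finrank ℂ (homWDIn (stringModel (ρ) (hρ) d) (σ) (A ⊔ B)) : ℤ) - (Module.finrank ℂ (homWDIn (stringModel (ρ) (hρ) (d - 1)) (σ) (A ⊔ B)) : ℤ) -
      ((Module.finrank ℂ (homWDIn (stringModel (twistRep (ρ) (-1)) (isContinuousRep_twistRep (hρ) (-1)) (d + 1)) (σ) (A ⊔ B)) : ℤ) -
        (Module.finrank ℂ (homWDIn (stringModel (twistRep (ρ) (-1)) (isContinuousRep_twistRep (hρ) (-1)) d) (σ) (A ⊔ B)) : ℤ))) = ((Module.finrank ℂ (homWDIn (stringModel (ρ) (hρ) d) (σ) A) : ℤ) - (Module.finrank ℂ (homWDIn (stringModel (ρ) (hρ) (d - 1)) (σ) A) : ℤ) -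
      ((Module.finrank ℂ (homWDIn (stringModel (twistRep (ρ) (-1)) (isContinuousRep_twistRep (hρ) (-1)) (d + 1)) (σ) A) : ℤ) -
        (Module.finrank ℂ (homWDIn (stringModel (twistRep (ρ) (-1)) (isContinuousRep_twistRep (hρ) (-1)) d) (σ) A) : ℤ))) + ((Module.finrank ℂ (homWDIn (stringModel (ρ) (hρ) d) (σ) B) : ℤ) - (Module.finrank ℂ (homWDIn (stringModel (ρ) (hρ) (d - 1)) (σ) B) : ℤ) -
      ((Module.finrank ℂ (homWDIn (stringModel (twistRep (ρ) (-1)) (isContinuousRep_twistRep (hρ) (-1)) (d + 1)) (σ) B) : ℤ) -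
        (Module.finrank ℂ (homWDIn (stringModel (twistRep (ρ) (-1)) (isContinuousRep_twistRep (hρ) (-1)) d) (σ) B) : ℤ))) := by
  simp only [K_sup _ _ _ σ hA hB hAB, Nat.cast_add]
  ring

/-- **`c` on a single string**: `c_{string(H₁, e₁)}(ρ, d) = [ρ_{H₁} ≅ ρ ∧ d = e₁]` for `d ≥ 1`
(the four `K`-values are indicators governed by the unique twist `j` with `ρ ≅ ρ_{H₁} ⊗ ‖·‖^j`).
[cite: HenniartBSMF2002, §4] -/
theorem c_stringSpan [Nontrivial Hp] (ρ : Representation ℂ (WeilGroup F) Hp)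
    (hρ : WeilGroup.IsContinuousRep ρ) (hirr : ρ.IsIrreducible) {d : ℕ} (hd : 1 ≤ d)
    {H₁ : Submodule ℂ V} {e₁ : ℕ} (h : IsStringHead σ H₁ e₁) :
    ((IsoTw (σ.ρ.subrepresentation H₁ h.irreducible.2.1) 0 ρ ∧ d = e₁) →
      ((Module.finrank ℂ (homWDIn (stringModel (ρ) (hρ) d) (σ) (stringSpan σ H₁ e₁)) : ℤ) - (Module.finrank ℂ (homWDIn (stringModel (ρ) (hρ) (d - 1)) (σ) (stringSpan σ H₁ e₁)) : ℤ) -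
      ((Module.finrank ℂ (homWDIn (stringModel (twistRep (ρ) (-1)) (isContinuousRep_twistRep (hρ) (-1)) (d + 1)) (σ) (stringSpan σ H₁ e₁)) : ℤ) -
        (Module.finrank ℂ (homWDIn (stringModel (twistRep (ρ) (-1)) (isContinuousRep_twistRep (hρ) (-1)) d) (σ) (stringSpan σ H₁ e₁)) : ℤ))) = 1) ∧
    (¬ (IsoTw (σ.ρ.subrepresentation H₁ h.irreducible.2.1) 0 ρ ∧ d = e₁) →
      ((Module.finrank ℂ (homWDIn (stringModel (ρ) (hρ) d) (σ) (stringSpan σ H₁ e₁)) : ℤ) - (Module.finrank ℂ (homWDIn (stringModel (ρ) (hρ) (d - 1)) (σ) (stringSpan σ H₁ e₁)) : ℤ) -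
      ((Module.finrank ℂ (homWDIn (stringModel (twistRep (ρ) (-1)) (isContinuousRep_twistRep (hρ) (-1)) (d + 1)) (σ) (stringSpan σ H₁ e₁)) : ℤ) -
        (Module.finrank ℂ (homWDIn (stringModel (twistRep (ρ) (-1)) (isContinuousRep_twistRep (hρ) (-1)) d) (σ) (stringSpan σ H₁ e₁)) : ℤ))) = 0) := by
  classical
  haveI : Nontrivial H₁ := Submodule.nontrivial_iff_ne_bot.mpr h.irreducible.1
  set ρ₁ := σ.ρ.subrepresentation H₁ h.irreducible.2.1 with hρ₁
  have hirr' : (twistRep ρ (-1)).IsIrreducible := isIrreducible_twistRep hirr (-1)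
  -- the four `K` as indicators
  have hK : ∀ n : ℕ, (Module.finrank ℂ (homWDIn (stringModel (ρ) (hρ) n) (σ) (stringSpan σ H₁ e₁)) : ℤ) =
      if ∃ i : ℕ, i < e₁ ∧ IsoTw ρ₁ (i : ℤ) ρ ∧ e₁ ≤ n + i then 1 else 0 := by
    intro n
    split_ifs with hc
    · exact_mod_cast (K_stringSpan ρ hρ hirr n h).1 hc
    · exact_mod_cast (K_stringSpan ρ hρ hirr n h).2 hc
  have hK' : ∀ n : ℕ, (Module.finrank ℂ (homWDIn (stringModel (twistRep ρ (-1)) (isContinuousRep_twistRep hρ (-1)) n) (σ) (stringSpan σ H₁ e₁)) : ℤ) =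
      if ∃ i : ℕ, i < e₁ ∧ IsoTw ρ₁ (i : ℤ) (twistRep ρ (-1)) ∧ e₁ ≤ n + i then 1 else 0 := by
    intro n
    split_ifs with hc
    · exact_mod_cast (K_stringSpan (twistRep ρ (-1)) (isContinuousRep_twistRep hρ (-1)) hirr' n h).1 hc
    · exact_mod_cast (K_stringSpan (twistRep ρ (-1)) (isContinuousRep_twistRep hρ (-1)) hirr' n h).2 hc
  by_cases hj : ∃ j : ℕ, IsoTw ρ₁ (j : ℤ) ρ
  · obtain ⟨j, hjiso⟩ := hj
    have huniq : ∀ i : ℕ, IsoTw ρ₁ (i : ℤ) ρ ↔ i = j := fun i =>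
      ⟨fun hi => by exact_mod_cast isoTw_unique hi hjiso, fun hi => hi ▸ hjiso⟩
    have huniq' : ∀ i : ℕ, IsoTw ρ₁ (i : ℤ) (twistRep ρ (-1)) ↔ i + 1 = j := fun i => by
      rw [isoTw_twist_neg_one_iff, show ((i : ℤ) + 1) = ((i + 1 : ℕ) : ℤ) by push_cast; rfl, huniq]
    have h0 : IsoTw ρ₁ 0 ρ ↔ 0 = j := by exact_mod_cast huniq 0
    have hP : ∀ n : ℕ, (∃ i : ℕ, i < e₁ ∧ IsoTw ρ₁ (i : ℤ) ρ ∧ e₁ ≤ n + i) ↔ (j < e₁ ∧ e₁ ≤ n + j) := fun n =>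
      ⟨fun ⟨i, hi, hiso, hle⟩ => by obtain rfl := (huniq i).mp hiso; exact ⟨hi, hle⟩,
        fun ⟨hj, hle⟩ => ⟨j, hj, hjiso, hle⟩⟩
    have hP' : ∀ n : ℕ, (∃ i : ℕ, i < e₁ ∧ IsoTw ρ₁ (i : ℤ) (twistRep ρ (-1)) ∧ e₁ ≤ n + i) ↔
        (1 ≤ j ∧ j ≤ e₁ ∧ e₁ + 1 ≤ n + j) := fun n =>
      ⟨fun ⟨i, hi, hiso, hle⟩ => by have := (huniq' i).mp hiso; omega,
        fun ⟨h1, h2, h3⟩ => ⟨j - 1, by omega, (huniq' (j - 1)).mpr (by omega), by omega⟩⟩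
    simp only [hK, hK', hP, hP', h0]
    constructor
    · rintro ⟨hj0, rfl⟩
      have hj0' : j = 0 := hj0.symm
      subst hj0'
      have he : 0 < d := hd
      simp only [zero_lt_iff, add_zero]
      rw [if_pos ⟨he.ne', le_rfl⟩, if_neg (by omega), if_neg (by omega), if_neg (by omega)]
      norm_num
    · intro hno
      have hno' : ¬ (0 = j ∧ d = e₁) := hno
      split_ifs <;> omega
  · -- no twist at all: everything vanishes
    have hP : ∀ n : ℕ, ¬ ∃ i : ℕ, i < e₁ ∧ IsoTw ρ₁ (i : ℤ) ρ ∧ e₁ ≤ n + i :=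
      fun n ⟨i, _, hiso, _⟩ => hj ⟨i, hiso⟩
    have hP' : ∀ n : ℕ, ¬ ∃ i : ℕ, i < e₁ ∧ IsoTw ρ₁ (i : ℤ) (twistRep ρ (-1)) ∧ e₁ ≤ n + i := by
      rintro n ⟨i, _, hiso, _⟩
      refine hj ⟨i + 1, ?_⟩
      have := (isoTw_twist_neg_one_iff ρ₁ ρ i).mp hiso
      push_cast
      exact this
    have h0 : ¬ IsoTw ρ₁ 0 ρ := fun h0 => hj ⟨0, by exact_mod_cast h0⟩
    simp only [hK, hK', if_neg (hP _), if_neg (hP' _), sub_self]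
    exact ⟨fun hc => (h0 hc.1).elim, by simp⟩

/-- **`c ≥ 0`** on every sub-Weil–Deligne representation of a Frobenius-semisimple `σ` (`d ≥ 1`):
induct along string summands, `c` being `0` or `1` on a string. [cite: HenniartBSMF2002, §4] -/
theorem c_nonneg [Nontrivial Hp] (hσ : σ.IsFrobSemisimple) (ρ : Representation ℂ (WeilGroup F) Hp)
    (hρ : WeilGroup.IsContinuousRep ρ) (hirr : ρ.IsIrreducible) {d : ℕ} (hd : 1 ≤ d) :
    ∀ (m : ℕ) (U : Submodule ℂ V), finrank ℂ U = m → σ.IsSubrep U → 0 ≤ ((Module.finrank ℂ (homWDIn (stringModel (ρ) (hρ) d) (σ) U) : ℤ) - (Module.finrank ℂ (homWDIn (stringModel (ρ) (hρ) (d - 1)) (σ) U) : ℤ) -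
      ((Module.finrank ℂ (homWDIn (stringModel (twistRep (ρ) (-1)) (isContinuousRep_twistRep (hρ) (-1)) (d + 1)) (σ) U) : ℤ) -
        (Module.finrank ℂ (homWDIn (stringModel (twistRep (ρ) (-1)) (isContinuousRep_twistRep (hρ) (-1)) d) (σ) U) : ℤ))) := by
  intro m
  induction m using Nat.strong_induction_on with
  | _ m ih =>
    intro U hm hU
    by_cases hU0 : U = ⊥
    · subst hU0; rw [c_bot]
    obtain ⟨H', e, C, h, _, hC, _, hSC, hdisj⟩ := exists_isStringHead_summand hσ hU hU0
    have hS := isSubrep_stringSpan h.irreducible.2.1 h.le_ker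
    have hS0 : stringSpan σ H' e ≠ ⊥ := fun h0 => h.irreducible.1 (by
      rw [eq_bot_iff, ← h0]
      obtain ⟨e', he'⟩ : ∃ e', e = e' + 1 := ⟨e - 1, by have := h.pos; omega⟩
      rw [he']; exact le_stringSpan_succ σ H' e')
    have hCm : finrank ℂ C < m := by
      have := finrank_sup_of_disjoint hdisj
      rw [hSC, hm] at this
      have : 0 < finrank ℂ ↥(stringSpan σ H' e) :=
        finrank_pos_iff.mpr (Submodule.nontrivial_iff_ne_bot.mpr hS0)
      omega
    rw [← hSC, c_sup ρ hρ d hS hC hdisj]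
    refine add_nonneg ?_ (ih _ hCm C rfl hC)
    classical
    by_cases hc : IsoTw (σ.ρ.subrepresentation H' h.irreducible.2.1) 0 ρ ∧ d = e
    · rw [(c_stringSpan ρ hρ hirr hd h).1 hc]; exact zero_le_one
    · rw [(c_stringSpan ρ hρ hirr hd h).2 hc]

/-- **Matching a string** (registered sub-goal below): if `c_U(ρ, d) ≠ 0` then `U` has a string
summand `string(H', d)` with `ρ_{H'} ≅ ρ` (induct along string summands: either the first summand
matches, or `c` of its complement is still non-zero). [cite: HenniartBSMF2002, §4] -/
theorem exists_string_of_c_ne_zero [Nontrivial Hp] (hσ : σ.IsFrobSemisimple)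
    (ρ : Representation ℂ (WeilGroup F) Hp) (hρ : WeilGroup.IsContinuousRep ρ) (hirr : ρ.IsIrreducible)
    {d : ℕ} (hd : 1 ≤ d) :
    ∀ (m : ℕ) (U : Submodule ℂ V), finrank ℂ U = m → σ.IsSubrep U → ((Module.finrank ℂ (homWDIn (stringModel (ρ) (hρ) d) (σ) U) : ℤ) - (Module.finrank ℂ (homWDIn (stringModel (ρ) (hρ) (d - 1)) (σ) U) : ℤ) -
      ((Module.finrank ℂ (homWDIn (stringModel (twistRep (ρ) (-1)) (isContinuousRep_twistRep (hρ) (-1)) (d + 1)) (σ) U) : ℤ) -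
        (Module.finrank ℂ (homWDIn (stringModel (twistRep (ρ) (-1)) (isContinuousRep_twistRep (hρ) (-1)) d) (σ) U) : ℤ))) ≠ 0 →
      ∃ (H' C : Submodule ℂ V) (h : IsStringHead σ H' d),
        IsoTw (σ.ρ.subrepresentation H' h.irreducible.2.1) 0 ρ ∧ σ.IsSubrep C ∧ C ≤ U ∧
        stringSpan σ H' d ≤ U ∧ stringSpan σ H' d ⊔ C = U ∧ Disjoint (stringSpan σ H' d) C := by
  intro m
  induction m using Nat.strong_induction_on with
  | _ m ih =>
    intro U hm hU hc
    have hU0 : U ≠ ⊥ := by rintro rfl; exact hc (c_bot ρ hρ d)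
    obtain ⟨H₁, e₁, C₁, h₁, hS₁U, hC₁, hC₁U, hSC₁, hdisj₁⟩ := exists_isStringHead_summand hσ hU hU0
    have hS₁ := isSubrep_stringSpan h₁.irreducible.2.1 h₁.le_ker
    classical
    by_cases hmatch : IsoTw (σ.ρ.subrepresentation H₁ h₁.irreducible.2.1) 0 ρ ∧ d = e₁
    · obtain ⟨hiso, rfl⟩ := hmatch
      exact ⟨H₁, C₁, h₁, hiso, hC₁, hC₁U, hS₁U, hSC₁, hdisj₁⟩
    · have hc₁ : ((Module.finrank ℂ (homWDIn (stringModel (ρ) (hρ) d) (σ) C₁) : ℤ) - (Module.finrank ℂ (homWDIn (stringModel (ρ) (hρ) (d - 1)) (σ) C₁) : ℤ) -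
      ((Module.finrank ℂ (homWDIn (stringModel (twistRep (ρ) (-1)) (isContinuousRep_twistRep (hρ) (-1)) (d + 1)) (σ) C₁) : ℤ) -
        (Module.finrank ℂ (homWDIn (stringModel (twistRep (ρ) (-1)) (isContinuousRep_twistRep (hρ) (-1)) d) (σ) C₁) : ℤ))) ≠ 0 := by
        rw [← hSC₁, c_sup ρ hρ d hS₁ hC₁ hdisj₁, (c_stringSpan ρ hρ hirr hd h₁).2 hmatch, zero_add] at hc
        exact hc
      have hS0 : stringSpan σ H₁ e₁ ≠ ⊥ := fun h0 => h₁.irreducible.1 (by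
        rw [eq_bot_iff, ← h0]
        obtain ⟨e', he'⟩ : ∃ e', e₁ = e' + 1 := ⟨e₁ - 1, by have := h₁.pos; omega⟩
        rw [he']; exact le_stringSpan_succ σ H₁ e')
      have hCm : finrank ℂ C₁ < m := by
        have := finrank_sup_of_disjoint hdisj₁
        rw [hSC₁, hm] at this
        have : 0 < finrank ℂ ↥(stringSpan σ H₁ e₁) :=
          finrank_pos_iff.mpr (Submodule.nontrivial_iff_ne_bot.mpr hS0)
        omega
      obtain ⟨H', C', h, hiso, hC', hC'C₁, hSC₁', hSC', hdisj'⟩ := ih _ hCm C₁ rfl hC₁ hc₁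
      refine ⟨H', C' ⊔ stringSpan σ H₁ e₁, h, hiso, isSubrep_sup hC' hS₁,
        sup_le (hC'C₁.trans hC₁U) hS₁U, hSC₁'.trans hC₁U, ?_, ?_⟩
      · rw [← sup_assoc, hSC', sup_comm, hSC₁]
      · rw [Submodule.disjoint_def]
        intro x hx hx'
        obtain ⟨c, hcC, s, hs, rfl⟩ := Submodule.mem_sup.mp hx'
        have hsC₁ : s ∈ C₁ := by
          have h1 : c + s - c ∈ stringSpan σ H' d ⊔ C' := Submodule.sub_mem _
            ((Submodule.mem_sup_left hx : c + s ∈ stringSpan σ H' d ⊔ C')) (Submodule.mem_sup_right hcC)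
          rw [add_sub_cancel_left, hSC'] at h1
          exact h1
        have hs0 : s = 0 := (Submodule.disjoint_def.mp hdisj₁) s hs hsC₁
        rw [hs0, add_zero] at hx ⊢
        exact (Submodule.disjoint_def.mp hdisj') c hx hcC

end Count

/-- **Registered sub-goal `stub_exists_string_summand_of_count_ne_zero`** (Henniart 2002, §4: the
count `c_U(ρ, d) = [K_U(ρ,d) - K_U(ρ,d-1)] - [K_U(ρ⊗‖·‖⁻¹, d+1) - K_U(ρ⊗‖·‖⁻¹, d)]`, `K_U(ρ, d) =
dim Hom_WD(ρ ⊗ Sp(d), σ; U)`, detects string summands with head `≅ ρ` and length `d`): if it is non-zero,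
`U` splits as `string(H', d) ⊕ C` with `ρ_{H'} ≅ ρ`. [cite: HenniartBSMF2002, §4] -/
theorem stub_exists_string_summand_of_count_ne_zero : ∀ (F : Type) [Field F] [ValuativeRel F] [TopologicalSpace F] [IsNonarchimedeanLocalField F] (V : Type) [AddCommGroup V] [Module ℂ V] [FiniteDimensional ℂ V] (σ : WeilDeligneRep F ℂ V), σ.IsFrobSemisimple → ∀ (Hp : Type) [AddCommGroup Hp] [Module ℂ Hp] [FiniteDimensional ℂ Hp] [Nontrivial Hp] (ρ : Representation ℂ (WeilGroup F) Hp) (hρ : WeilGroup.IsContinuousRep ρ) [ρ.IsIrreducible] (d : ℕ), 1 ≤ d → ∀ (U : Submodule ℂ V), σ.IsSubrep U → (Module.finrank ℂ ↥(homWDIn (stringModel ρ hρ d) σ U) : ℤ) - (Module.finrank ℂ ↥(homWDIn (stringModel ρ hρ (d - 1)) σ U) : ℤ) - ((Module.finrank ℂ ↥(homWDIn (stringModel (twistRep ρ (-1)) (isContinuousRep_twistRep hρ (-1)) (d + 1)) σ U) : ℤ) - (Module.finrank ℂ ↥(homWDIn (stringModel (twistRep ρ (-1)) (isContinuousRep_twistRep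 hρ (-1)) d) σ U) : ℤ)) ≠ 0 → ∃ (H' C : Submodule ℂ V) (h : IsStringHead σ H' d), IsoTw (σ.ρ.subrepresentation H' h.irreducible.2.1) 0 ρ ∧ σ.IsSubrep C ∧ C ≤ U ∧ stringSpan σ H' d ≤ U ∧ stringSpan σ H' d ⊔ C = U ∧ Disjoint (stringSpan σ H' d) C :=
  fun _ _ _ _ _ _ _ _ _ _ hσ _ _ _ _ _ ρ hρ hirr _ hd U hU hc =>
    exists_string_of_c_ne_zero hσ ρ hρ hirr hd _ U rfl hU hc

end Summit.Langlands.Langlands.Theorems.ReciprocityUpToIrreducibilityR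

end
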